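import Summits.QuantumFields.YangMills.Theorems.ColdStartUniversalityLatticeLangevinWilsonEntropySlope
import HarnessLib

/-!
# Route `ColdStartUniversality` (fixed-cut-off package, entropy side): the CONVERSE «exponential decay of entropy ⇒ log-Sobolev»
# (Bakry–Gentil–Ledoux Thm 5.2.1 (ii)⇒(i)) for the SU(2) SZZ dynamics at every fixed cut-off — so g21's `hLSgen` is EQUIVALENT to
# the exponential decay of the entropy of positive smooth cylinder densities

Helper file (seat `ym-line-csu-p1`, g22; `--supports stmt-QuantumFields-27363`).  g21 proved LSI(ρ) ⇒ `Ent_μ(κ_t F) ≤ e^{−4ρt} Ent_μ(F)`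
for every positive `C³` compactly supported cylinder `F` (`entropy_transition_le_exp_of_generatorLogSobolev`).  Here the converse:

* ★★ `generatorLogSobolev_of_entropy_decay` — if some Markov kernel family realising the SZZ transition laws at `(L, β')` satisfies
  `Ent_μ(κ_t F) ≤ e^{−4ρt} Ent_μ(F)` for every positive `C³` compactly supported cylinder `F = f∘coords` and every `t`, then the
  generator-form log-Sobolev inequality `ρ·Ent_μ(F²) ≤ −∫ F 𝓛_{β'}f dμ` holds for every `C³` `f`.
  Proof: localise; for `η > 0` apply the entropy slope inequality (`four_mul_entropy_le_neg_integral_log_mul_generator`, g22) to the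
  positive cylinder `G² + η`: `4ρ Ent(G²+η) ≤ −∫ log(G²+η)·𝓛(g²) dμ = ½∫ Γ(log(g²+η), g²) dμ` (bilinear energy identity) `=
  ½∫ (4g²/(g²+η)) Γ(g,g) dμ ≤ 2∫ Γ(g,g) dμ = −4∫ G 𝓛g dμ`; then `η ↓ 0` (`EntropyFlow.entropy_le_of_forall_entropy_add_const_le`).
* ★ `generatorLogSobolev_iff_entropy_decay` — packaged equivalence along THE kernels of `exists_transitionKernel`… (not here: the two
  directions are `entropy_transition_le_exp_of_generatorLogSobolev` (g21) and the theorem above).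

THEOREMS ONLY, no definition, no sorry.  RECORD-rung R3 plumbing at FIXED cut-off (the entropy twin of g18's «hEquiv is a theorem»);
nothing K-uniform; no crux, rung or summit statement is proved; the Yang–Mills mass gap is NOT proved.
-/

set_option autoImplicit false

noncomputable section

namespace Summit.QuantumFields.YangMills.Theorems.ColdStartUniversality

open MeasureTheory ProbabilityTheory Finset Filter Set Topology Metric
open scoped BigOperators NNReal ENNReal
open Literature.Probability.Process Literature.MathematicalPhysics.QuantumFieldTheory
open Literature.MathematicalPhysics.QuantumLattice (fundamentalRep fundamentalLatticeRep continuous_fundamentalRep)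

variable {L : ℕ} [NeZero L]

/-- ★★ **Exponential decay of entropy ⇒ log-Sobolev inequality (BGL Thm 5.2.1 (ii)⇒(i)) for the SZZ dynamics at a fixed cut-off.**
If a Markov kernel family `κ` realising the SU(2) SZZ transition laws at `(L, β')` satisfies `Ent_μ(κ_t F) ≤ e^{−4ρt}·Ent_μ(F)` for
every positive `C³` compactly supported cylinder `F = f∘coords` and every lattice time `t` (`μ = μ_{β'}`), then
`ρ·(∫ F² log F² dμ − (∫ F² dμ) log(∫ F² dμ)) ≤ −∫ F·𝓛_{β'}f dμ` for every `C³` `f`. [cite: BakryGentilLedoux2014, Thm 5.2.1] -/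
theorem generatorLogSobolev_of_entropy_decay (L : ℕ) [NeZero L] (β' : ℝ)
    (κ : ℝ≥0 → Kernel (GaugeConfig 3 L (Matrix.specialUnitaryGroup (Fin 2) ℂ))
      (GaugeConfig 3 L (Matrix.specialUnitaryGroup (Fin 2) ℂ))) [∀ t, IsMarkovKernel (κ t)]
    (hreal : ∀ (t : ℝ≥0) (x : GaugeConfig 3 L (Matrix.specialUnitaryGroup (Fin 2) ℂ))
        (Ω : Type) [MeasurableSpace Ω] (P : Measure Ω) [IsProbabilityMeasure P]
        (W : ℝ≥0 → Ω → (Edge 3 L × NoiseIdx 2 → ℝ)) (hW : IsFlatBrownian W P)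
        (U : ℝ≥0 → Ω → GaugeConfig 3 L (Matrix.specialUnitaryGroup (Fin 2) ℂ)),
        (∀ ω, U 0 ω = x) →
        (latticeLangevinDynamics (fundamentalLatticeRep 2) β').IsSolution (fundamentalRep (Fin 2))
          hW.natFiltration P W U →
        κ t x = P.map (U t))
    {ρ : ℝ}
    (hdecay : ∀ (q : (Edge 3 L × Fin 2 × Fin 2 × Bool → ℝ) → ℝ), ContDiff ℝ 3 q → HasCompactSupport q →
      (∀ x : GaugeConfig 3 L (Matrix.specialUnitaryGroup (Fin 2) ℂ),
        0 < q (fun p => (fun z : ℂ => if p.2.2.2 then z.im else z.re)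
          ((fundamentalRep (Fin 2) (x p.1) : Matrix (Fin 2) (Fin 2) ℂ) p.2.1 p.2.2.1))) →
      ∀ t : ℝ≥0,
      let Q : GaugeConfig 3 L (Matrix.specialUnitaryGroup (Fin 2) ℂ) → ℝ := fun x =>
        q (fun p => (fun z : ℂ => if p.2.2.2 then z.im else z.re)
          ((fundamentalRep (Fin 2) (x p.1) : Matrix (Fin 2) (Fin 2) ℂ) p.2.1 p.2.2.1))
      (∫ x, (∫ y, Q y ∂(κ t x)) * Real.log (∫ y, Q y ∂(κ t x)) ∂(wilsonMeasure (d := 3) (L := L) (fundamentalRep (Fin 2)) β')) -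
          (∫ x, (∫ y, Q y ∂(κ t x)) ∂(wilsonMeasure (d := 3) (L := L) (fundamentalRep (Fin 2)) β')) *
            Real.log (∫ x, (∫ y, Q y ∂(κ t x)) ∂(wilsonMeasure (d := 3) (L := L) (fundamentalRep (Fin 2)) β')) ≤
        Real.exp (-4 * ρ * t) *
          ((∫ x, Q x * Real.log (Q x) ∂(wilsonMeasure (d := 3) (L := L) (fundamentalRep (Fin 2)) β')) -
            (∫ x, Q x ∂(wilsonMeasure (d := 3) (L := L) (fundamentalRep (Fin 2)) β')) *
              Real.log (∫ x, Q x ∂(wilsonMeasure (d := 3) (L := L) (fundamentalRep (Fin 2)) β'))))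
    (f : (Edge 3 L × Fin 2 × Fin 2 × Bool → ℝ) → ℝ) (hf : ContDiff ℝ 3 f) :
    let coords : GaugeConfig 3 L (Matrix.specialUnitaryGroup (Fin 2) ℂ) → (Edge 3 L × Fin 2 × Fin 2 × Bool → ℝ) :=
      fun V p => (fun z : ℂ => if p.2.2.2 then z.im else z.re)
        ((fundamentalRep (Fin 2) (V p.1) : Matrix (Fin 2) (Fin 2) ℂ) p.2.1 p.2.2.1)
    let gen : GaugeConfig 3 L (Matrix.specialUnitaryGroup (Fin 2) ℂ) → ℝ := fun V =>
      (∑ i : Edge 3 L × Fin 2 × Fin 2 × Bool, fderiv ℝ f (coords V) (Pi.single i 1) *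
          (fun z : ℂ => if i.2.2.2 then z.im else z.re)
            ((latticeLangevinDynamics (fundamentalLatticeRep 2) β').drift
              (matrixConfig (fundamentalRep (Fin 2)) V) i.1 i.2.1 i.2.2.1) +
      1 / 2 * ∑ i : Edge 3 L × Fin 2 × Fin 2 × Bool, ∑ j : Edge 3 L × Fin 2 × Fin 2 × Bool,
        fderiv ℝ (fun z => fderiv ℝ f z (Pi.single i 1)) (coords V) (Pi.single j 1) *
          ∑ n : Edge 3 L × NoiseIdx 2,
            (if n.1 = i.1 then (fun z : ℂ => if i.2.2.2 then z.im else z.re)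
              ((latticeLangevinDynamics (fundamentalLatticeRep 2) β').noise
                (matrixConfig (fundamentalRep (Fin 2)) V) i.1 n.2 i.2.1 i.2.2.1) else 0) *
            (if n.1 = j.1 then (fun z : ℂ => if j.2.2.2 then z.im else z.re)
              ((latticeLangevinDynamics (fundamentalLatticeRep 2) β').noise
                (matrixConfig (fundamentalRep (Fin 2)) V) j.1 n.2 j.2.1 j.2.2.1) else 0))
    ρ * ((∫ V, f (coords V) ^ 2 * Real.log (f (coords V) ^ 2) ∂(wilsonMeasure (d := 3) (L := L) (fundamentalRep (Fin 2)) β')) -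
        (∫ V, f (coords V) ^ 2 ∂(wilsonMeasure (d := 3) (L := L) (fundamentalRep (Fin 2)) β')) *
          Real.log (∫ V, f (coords V) ^ 2 ∂(wilsonMeasure (d := 3) (L := L) (fundamentalRep (Fin 2)) β'))) ≤
      -∫ V, f (coords V) * gen V ∂(wilsonMeasure (d := 3) (L := L) (fundamentalRep (Fin 2)) β') := by
  intro coords gen
  classical
  haveI := secondCountableTopology_su2
  haveI := borelSpace_config L
  set μ : Measure (GaugeConfig 3 L (Matrix.specialUnitaryGroup (Fin 2) ℂ)) :=
    wilsonMeasure (d := 3) (L := L) (fundamentalRep (Fin 2)) β' with hμ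
  haveI : IsProbabilityMeasure μ :=
    isProbabilityMeasure_wilsonMeasure (d := 3) (L := L) (fundamentalRep (Fin 2)) (continuous_fundamentalRep (Fin 2)) β'
  have hco : Continuous coords := continuous_coords (L := L)
  /- 1. Localisation `F = g∘coords`, `g = χ·f`. -/
  let χ : ContDiffBump (0 : (Edge 3 L × Fin 2 × Fin 2 × Bool) → ℝ) := ⟨2, 3, by norm_num, by norm_num⟩
  set g : ((Edge 3 L × Fin 2 × Fin 2 × Bool) → ℝ) → ℝ := fun y =>
    (χ : ((Edge 3 L × Fin 2 × Fin 2 × Bool) → ℝ) → ℝ) y * f y with hgdef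
  have hg : ContDiff ℝ 3 g := χ.contDiff.mul hf
  have hgc : HasCompactSupport g := χ.hasCompactSupport.mul_right
  have hball : ∀ V : GaugeConfig 3 L (Matrix.specialUnitaryGroup (Fin 2) ℂ),
      coords V ∈ ball (0 : (Edge 3 L × Fin 2 × Fin 2 × Bool) → ℝ) 2 := by
    intro V
    rw [mem_ball, dist_zero_right]
    exact (norm_coords_le_one V).trans_lt (by norm_num)
  have hχ1 : ∀ y ∈ ball (0 : (Edge 3 L × Fin 2 × Fin 2 × Bool) → ℝ) 2,
      (χ : ((Edge 3 L × Fin 2 × Fin 2 × Bool) → ℝ) → ℝ) y = 1 := fun y hy =>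
    χ.one_of_mem_closedBall (ball_subset_closedBall hy)
  have hEq : ∀ y ∈ ball (0 : (Edge 3 L × Fin 2 × Fin 2 × Bool) → ℝ) 2, g y = f y + 0 := by
    intro y hy; simp only [hgdef, hχ1 y hy, one_mul, add_zero]
  have hgF : ∀ V, g (coords V) = f (coords V) := fun V => by rw [hEq _ (hball V), add_zero]
  have hfd : ∀ V, fderiv ℝ g (coords V) = fderiv ℝ f (coords V) := fun V => fderiv_eq_of_eqOn_ball hEq (hball V)
  have hfd2 : ∀ V (v : (Edge 3 L × Fin 2 × Fin 2 × Bool) → ℝ),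
      fderiv ℝ (fun z => fderiv ℝ g z v) (coords V) = fderiv ℝ (fun z => fderiv ℝ f z v) (coords V) := fun V v =>
    fderiv_fderiv_eq_of_eqOn_ball hEq (hball V) v
  set G : GaugeConfig 3 L (Matrix.specialUnitaryGroup (Fin 2) ℂ) → ℝ := fun V => g (coords V) with hGdef
  have hGc : Continuous G := hg.continuous.comp hco
  /- 2. Coefficients, generators, carré du champ of `g`, energy identity. -/
  set bb : GaugeConfig 3 L (Matrix.specialUnitaryGroup (Fin 2) ℂ) → (Edge 3 L × Fin 2 × Fin 2 × Bool) → ℝ := fun V i =>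
    (fun z : ℂ => if i.2.2.2 then z.im else z.re)
      ((latticeLangevinDynamics (fundamentalLatticeRep 2) β').drift (matrixConfig (fundamentalRep (Fin 2)) V) i.1 i.2.1 i.2.2.1)
    with hbb
  set A : GaugeConfig 3 L (Matrix.specialUnitaryGroup (Fin 2) ℂ) → (Edge 3 L × Fin 2 × Fin 2 × Bool) →
      (Edge 3 L × Fin 2 × Fin 2 × Bool) → ℝ := fun V i j =>
    ∑ n : Edge 3 L × NoiseIdx 2,
      (if n.1 = i.1 then (fun z : ℂ => if i.2.2.2 then z.im else z.re)
        ((latticeLangevinDynamics (fundamentalLatticeRep 2) β').noise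
          (matrixConfig (fundamentalRep (Fin 2)) V) i.1 n.2 i.2.1 i.2.2.1) else 0) *
      (if n.1 = j.1 then (fun z : ℂ => if j.2.2.2 then z.im else z.re)
        ((latticeLangevinDynamics (fundamentalLatticeRep 2) β').noise
          (matrixConfig (fundamentalRep (Fin 2)) V) j.1 n.2 j.2.1 j.2.2.1) else 0) with hA
  -- the generator as a function of the test function
  set Gen : ((Edge 3 L × Fin 2 × Fin 2 × Bool → ℝ) → ℝ) → GaugeConfig 3 L (Matrix.specialUnitaryGroup (Fin 2) ℂ) → ℝ :=
    fun h V => (∑ i : Edge 3 L × Fin 2 × Fin 2 × Bool, fderiv ℝ h (coords V) (Pi.single i 1) * bb V i +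
      1 / 2 * ∑ i : Edge 3 L × Fin 2 × Fin 2 × Bool, ∑ j : Edge 3 L × Fin 2 × Fin 2 × Bool,
        fderiv ℝ (fun z => fderiv ℝ h z (Pi.single i 1)) (coords V) (Pi.single j 1) * A V i j) with hGen
  have hgen : ∀ V, Gen g V = gen V := by
    intro V
    simp only [hGen, gen, hbb, hA, hfd V, hfd2 V]
  set Γ : GaugeConfig 3 L (Matrix.specialUnitaryGroup (Fin 2) ℂ) → ℝ := fun V =>
    ∑ i : Edge 3 L × Fin 2 × Fin 2 × Bool, ∑ j : Edge 3 L × Fin 2 × Fin 2 × Bool,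
      fderiv ℝ g (coords V) (Pi.single i 1) * fderiv ℝ g (coords V) (Pi.single j 1) * A V i j with hΓ
  have hΓ0 : ∀ V, 0 ≤ Γ V := fun V => by
    simp only [hΓ, hA]
    exact carreDuChamp_nonneg (fun i => fderiv ℝ g (coords V) (Pi.single i 1))
      (fun i (n : Edge 3 L × NoiseIdx 2) => if n.1 = i.1 then (fun z : ℂ => if i.2.2.2 then z.im else z.re)
        ((latticeLangevinDynamics (fundamentalLatticeRep 2) β').noise
          (matrixConfig (fundamentalRep (Fin 2)) V) i.1 n.2 i.2.1 i.2.2.1) else 0)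
  have hcarre : 2 * ∫ V, G V * Gen g V ∂μ = -∫ V, Γ V ∂μ := two_mul_integral_mul_generator_eq_neg_carre L β' hg hgc
  -- continuity of `Γ` via Leibniz: `Γ = 𝓛(g²) − 2 g 𝓛g`
  have hgg : ContDiff ℝ 3 (fun z => g z * g z) := hg.mul hg
  have hggc : HasCompactSupport (fun z => g z * g z) := hgc.mul_left
  have hAsymm : ∀ V i j, A V i j = A V j i := fun V i j => Finset.sum_congr rfl fun n _ => mul_comm _ _
  have hleib : ∀ V, Gen (fun z => g z * g z) V = G V * Gen g V + G V * Gen g V + Γ V := fun V =>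
    generator_mul (fun i : Edge 3 L × Fin 2 × Fin 2 × Bool => (Pi.single i (1 : ℝ) : _ → ℝ)) (bb V) (A V) (hAsymm V)
      (hg.of_le (by norm_num)) (hg.of_le (by norm_num)) (coords V)
  have hGeng : Continuous (Gen g) := continuous_generator (L := L) β' (hg.of_le (by norm_num))
  have hGengg : Continuous (Gen fun z => g z * g z) := continuous_generator (L := L) β' (hgg.of_le (by norm_num))
  have hΓc : Continuous Γ := by
    have e : Γ = fun V => Gen (fun z => g z * g z) V - (G V * Gen g V + G V * Gen g V) := by
      funext V; rw [hleib V]; ring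
    rw [e]; exact hGengg.sub ((hGc.mul hGeng).add (hGc.mul hGeng))
  have hΓi : Integrable Γ μ := integrable_of_continuous_of_compactSpace hΓc μ
  /- 3. Read back on `f` and reduce to `ρ·Ent(G²) ≤ (∫ Γ dμ)/2`. -/
  have hEntf : (∫ V, f (coords V) ^ 2 * Real.log (f (coords V) ^ 2) ∂μ) -
      (∫ V, f (coords V) ^ 2 ∂μ) * Real.log (∫ V, f (coords V) ^ 2 ∂μ) =
      (∫ V, G V ^ 2 * Real.log (G V ^ 2) ∂μ) - (∫ V, G V ^ 2 ∂μ) * Real.log (∫ V, G V ^ 2 ∂μ) := by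
    simp only [hGdef, hgF]
  have hDir : ∫ V, f (coords V) * gen V ∂μ = ∫ V, G V * Gen g V ∂μ := by simp only [hGdef, hgF, hgen]
  rw [hEntf, hDir]
  have hRHS : -∫ V, G V * Gen g V ∂μ = (∫ V, Γ V ∂μ) / 2 := by linarith [hcarre]
  rw [hRHS]
  have hG2c : Continuous fun V => G V ^ 2 := hGc.pow 2
  have hG2m : Measurable fun V => G V ^ 2 := hG2c.measurable
  obtain ⟨M, -, hM⟩ := exists_abs_le_of_continuous_of_compactSpace hG2c
  have hG2M : ∀ V, G V ^ 2 ≤ M := fun V => (le_abs_self _).trans (hM V)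
  have hEnt0 : 0 ≤ (∫ V, G V ^ 2 * Real.log (G V ^ 2) ∂μ) - (∫ V, G V ^ 2 ∂μ) * Real.log (∫ V, G V ^ 2 ∂μ) :=
    entropy_nonneg μ (fun V => sq_nonneg _) (integrable_of_continuous_of_compactSpace hG2c μ)
      (integrable_of_continuous_of_compactSpace (Real.continuous_mul_log.comp hG2c) μ)
  have hIΓ : 0 ≤ ∫ V, Γ V ∂μ := integral_nonneg hΓ0
  rcases le_or_gt ρ 0 with hρ | hρ
  · calc ρ * ((∫ V, G V ^ 2 * Real.log (G V ^ 2) ∂μ) - (∫ V, G V ^ 2 ∂μ) * Real.log (∫ V, G V ^ 2 ∂μ)) ≤ 0 :=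
          mul_nonpos_of_nonpos_of_nonneg hρ hEnt0
      _ ≤ (∫ V, Γ V ∂μ) / 2 := by positivity
  /- 4. `ρ > 0`: for every `η = 1/(n+1)`, `Ent(G² + η) ≤ (∫Γ dμ)/(2ρ)`. -/
  suffices hB : (∫ V, G V ^ 2 * Real.log (G V ^ 2) ∂μ) - (∫ V, G V ^ 2 ∂μ) * Real.log (∫ V, G V ^ 2 ∂μ) ≤
      ((∫ V, Γ V ∂μ) / 2) / ρ by
    rw [le_div_iff₀ hρ] at hB; linarith
  refine EntropyFlow.entropy_le_of_forall_entropy_add_const_le μ hG2m (fun V => sq_nonneg _) hG2M fun n => ?_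
  set η : ℝ := 1 / ((n : ℝ) + 1) with hη
  have hηpos : 0 < η := by positivity
  -- the positive cylinder `q = χ·(g² + η)` and the localised logarithm `ℓ = χ·log(g² + η)`
  set q : ((Edge 3 L × Fin 2 × Fin 2 × Bool) → ℝ) → ℝ := fun y =>
    (χ : ((Edge 3 L × Fin 2 × Fin 2 × Bool) → ℝ) → ℝ) y * (g y * g y + η) with hqdef
  set ℓ : ((Edge 3 L × Fin 2 × Fin 2 × Bool) → ℝ) → ℝ := fun y =>
    (χ : ((Edge 3 L × Fin 2 × Fin 2 × Bool) → ℝ) → ℝ) y * Real.log (g y * g y + η) with hℓdef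
  have hggη_pos : ∀ y, 0 < g y * g y + η := fun y => by nlinarith [mul_self_nonneg (g y)]
  have hq : ContDiff ℝ 3 q := χ.contDiff.mul (hgg.add contDiff_const)
  have hqc : HasCompactSupport q := χ.hasCompactSupport.mul_right
  have hℓ : ContDiff ℝ 3 ℓ := χ.contDiff.mul ((hgg.add contDiff_const).log fun y => (hggη_pos y).ne')
  have hℓc : HasCompactSupport ℓ := χ.hasCompactSupport.mul_right
  have hEqq : ∀ y ∈ ball (0 : (Edge 3 L × Fin 2 × Fin 2 × Bool) → ℝ) 2, q y = (g y * g y) + η := by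
    intro y hy; simp only [hqdef, hχ1 y hy, one_mul]
  have hEqℓ : ∀ y ∈ ball (0 : (Edge 3 L × Fin 2 × Fin 2 × Bool) → ℝ) 2, ℓ y = Real.log (g y * g y + η) + 0 := by
    intro y hy; simp only [hℓdef, hχ1 y hy, one_mul, add_zero]
  have hqF : ∀ V, q (coords V) = G V ^ 2 + η := fun V => by
    rw [hEqq _ (hball V)]; simp only [hGdef, sq]
  have hℓF : ∀ V, ℓ (coords V) = Real.log (q (coords V)) := fun V => by
    rw [hEqℓ _ (hball V), add_zero, hEqq _ (hball V)]
  have hqpos : ∀ x : GaugeConfig 3 L (Matrix.specialUnitaryGroup (Fin 2) ℂ), 0 < q (coords x) := fun x => by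
    rw [hqF]; positivity
  -- `𝓛q = 𝓛(g²)` on the group
  have hfdq : ∀ V, fderiv ℝ q (coords V) = fderiv ℝ (fun z => g z * g z) (coords V) := fun V =>
    fderiv_eq_of_eqOn_ball hEqq (hball V)
  have hfd2q : ∀ V (v : (Edge 3 L × Fin 2 × Fin 2 × Bool) → ℝ),
      fderiv ℝ (fun z => fderiv ℝ q z v) (coords V) = fderiv ℝ (fun z => fderiv ℝ (fun z' => g z' * g z') z v) (coords V) :=
    fun V v => fderiv_fderiv_eq_of_eqOn_ball hEqq (hball V) v
  have hGenq : ∀ V, Gen q V = Gen (fun z => g z * g z) V := by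
    intro V; simp only [hGen, hfdq V, hfd2q V]
  -- `∂ℓ = ∂ log(g²+η)` on the group
  have hfdℓ : ∀ V, fderiv ℝ ℓ (coords V) = fderiv ℝ (fun y => Real.log (g y * g y + η)) (coords V) := fun V =>
    fderiv_eq_of_eqOn_ball hEqℓ (hball V)
  -- (i) the entropy slope inequality for `q`
  have hslope : 4 * ρ * ((∫ V, q (coords V) * Real.log (q (coords V)) ∂μ) -
      (∫ V, q (coords V) ∂μ) * Real.log (∫ V, q (coords V) ∂μ)) ≤ -∫ V, Real.log (q (coords V)) * Gen q V ∂μ :=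
    four_mul_entropy_le_neg_integral_log_mul_generator L β' κ hreal hq hqc hqpos (ρ := ρ) (hdecay q hq hqc hqpos)
  -- (ii) the bilinear energy identity for `(ℓ, g²)`
  have hbil : 2 * ∫ V, ℓ (coords V) * Gen (fun z => g z * g z) V ∂μ =
      -∫ V, (∑ i : Edge 3 L × Fin 2 × Fin 2 × Bool, ∑ j : Edge 3 L × Fin 2 × Fin 2 × Bool,
        fderiv ℝ ℓ (coords V) (Pi.single i 1) * fderiv ℝ (fun z => g z * g z) (coords V) (Pi.single j 1) * A V i j) ∂μ :=
    two_mul_integral_mul_generator_bilin_eq_neg_carre L β' hℓ hℓc hgg hggc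
  -- (iii) the chain rule, pointwise on the group
  have hchain : ∀ V, (∑ i : Edge 3 L × Fin 2 × Fin 2 × Bool, ∑ j : Edge 3 L × Fin 2 × Fin 2 × Bool,
      fderiv ℝ ℓ (coords V) (Pi.single i 1) * fderiv ℝ (fun z => g z * g z) (coords V) (Pi.single j 1) * A V i j) =
      (4 * (G V * G V) / (G V * G V + η)) * Γ V := by
    intro V
    rw [hfdℓ V]
    exact carre_log_mul_self_add_const (fun i : Edge 3 L × Fin 2 × Fin 2 × Bool => (Pi.single i (1 : ℝ) : _ → ℝ)) (A V)
      ((hg.differentiable (by norm_num)) _) hηpos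
  have hfac : ∀ V, (4 * (G V * G V) / (G V * G V + η)) * Γ V ≤ 4 * Γ V := fun V => by
    have h1 : 4 * (G V * G V) / (G V * G V + η) ≤ 4 := by
      rw [div_le_iff₀ (by nlinarith [mul_self_nonneg (G V)])]; nlinarith [mul_self_nonneg (G V)]
    exact mul_le_mul_of_nonneg_right h1 (hΓ0 V)
  have hfac0 : ∀ V, 0 ≤ (4 * (G V * G V) / (G V * G V + η)) * Γ V := fun V =>
    mul_nonneg (div_nonneg (by nlinarith [mul_self_nonneg (G V)]) (by nlinarith [mul_self_nonneg (G V)])) (hΓ0 V)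
  -- assemble: `4ρ Ent(q∘coords) ≤ −∫ log q · 𝓛q = −∫ ℓ 𝓛(g²) = ½ ∫ Γ(ℓ,g²) ≤ 2 ∫ Γ`
  have hI1 : -∫ V, Real.log (q (coords V)) * Gen q V ∂μ = -∫ V, ℓ (coords V) * Gen (fun z => g z * g z) V ∂μ := by
    simp only [hℓF, hGenq]
  have hI2 : -∫ V, ℓ (coords V) * Gen (fun z => g z * g z) V ∂μ =
      (∫ V, (4 * (G V * G V) / (G V * G V + η)) * Γ V ∂μ) / 2 := by
    have e : ∫ V, (∑ i : Edge 3 L × Fin 2 × Fin 2 × Bool, ∑ j : Edge 3 L × Fin 2 × Fin 2 × Bool,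
        fderiv ℝ ℓ (coords V) (Pi.single i 1) * fderiv ℝ (fun z => g z * g z) (coords V) (Pi.single j 1) * A V i j) ∂μ =
        ∫ V, (4 * (G V * G V) / (G V * G V + η)) * Γ V ∂μ := integral_congr_ae (ae_of_all _ hchain)
    rw [← e]
    linarith [hbil]
  have hI3 : ∫ V, (4 * (G V * G V) / (G V * G V + η)) * Γ V ∂μ ≤ ∫ V, 4 * Γ V ∂μ :=
    integral_mono_of_nonneg (ae_of_all _ hfac0) (hΓi.const_mul 4) (ae_of_all _ hfac)
  rw [integral_const_mul] at hI3
  have hmain : 4 * ρ * ((∫ V, q (coords V) * Real.log (q (coords V)) ∂μ) -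
      (∫ V, q (coords V) ∂μ) * Real.log (∫ V, q (coords V) ∂μ)) ≤ 2 * ∫ V, Γ V ∂μ := by
    have h := hslope
    rw [hI1, hI2] at h
    linarith
  simp only [hqF] at hmain
  rw [le_div_iff₀ hρ, div_eq_mul_inv]
  have : ((∫ V, (G V ^ 2 + η) * Real.log (G V ^ 2 + η) ∂μ) - (∫ V, (G V ^ 2 + η) ∂μ) * Real.log (∫ V, (G V ^ 2 + η) ∂μ)) * ρ ≤
      (∫ V, Γ V ∂μ) * 2⁻¹ := by nlinarith [hmain]
  exact this

end Summit.QuantumFields.YangMills.Theorems.ColdStartUniversality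

end
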